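import Summits.QuantumFields.YangMills.Theorems.AlphaInputsT3ACv3AbelianRegion
import Summits.QuantumFields.YangMills.Theorems.AlphaInputsT3ACv3InnerLiftFine
import HarnessLib

/-!
# `AlphaInputsT3ACv3AbelianFineLift` — STRATEGY B for 2′: (FL) FOR ABELIAN DATA REDUCED TO A **LINEAR** LIFT — if the charged datum is abelian on `bondsIn k Ω_k(h)` (`W = gexpAt A` along a
# direction `Y ∈ 𝔰𝔲(2)∖0`) and the coarse one-form `A` has a finest linear (0.4)-lift `a` with small curls UNDER `Ω_k(h)`, then `gexpAt a` is a witness of (FL) at `(k, h, W)` — lane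
# `pub-balaban3d`, seat alpha-2 (g4)

WHY (OWNER DEPMAP v3.3, 2026-08-27T22:38Z: the displayed W-dependent kinematic row of 2′∕2′χ is (FL) `AlphaInputsT3AC.InnerFineLiftsT3`; «abelian case first»).  For abelian data the
non-linear exactness `(blockAvg ℰp)^k U = W` becomes LINEAR in the one-form (`AbelianEML.iter_blockAvg_gexpAt_region`, sibling file: at the bonds under the region, from the curl bound
under the region only), and the fine plaquette distances are `≤ |curl a|·‖Y‖` (`dist1_plaqHol_gexpAt_le`).  THIS FILE: ★★ `fineLift_of_linearLift_abelian` — at `k ≤ K`, an admissible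
`h`, a direction `Y`, a coarse one-form `A` and a finest one-form `a` with (i) `linAvgIter k a = A` on `bondsIn k Ω_k(h)`, (ii) `|curl a|·‖Y‖` bounded by `B‖Y‖ < α·L^{−2k}` at the unit squares
inside `Ω_k(h)`, (iii) the level thresholds `(π/2)(((d+2)L)²/4)(L²)^s B‖Y‖ < min(δ_N, ln 2)` (`s < k`), the configuration `gexpAt a` lies in `top42Set k h W` for every `W` that equals
`gexpAt A` on `bondsIn k Ω_k(h)`, and its finest plaquettes inside `Ω_k(h)` are within `α·L^{−2k}` — i.e. it is a witness of the (FL) clause at `(k, h, W)`; `thresholds_of_fine_budget`: (iii)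
follows from (ii) and `(π/2)(((d+2)L)²/4)·α ≤ min(δ_N, ln 2)`.  So (FL) FOR ABELIAN DATA ⇐ (LL) the LINEAR REGIONAL LIFT PROBLEM «every coarse one-form `A` with `|curl A| ≤ ε` on
`plaqsIn k Ω` has a finest `a` with `linAvgIter k a = A` on `bondsIn k Ω` and `|curl a| ≤ B_lin·ε·L^{−2k}` on `plaqsIn 0 Ω`» — a statement of finite-dimensional linear algebra about the
(0.4) linear averaging on a union of level-`k` blocks (open; the natural compute∕successor target).
HONEST FRAMING.  (FL) is NOT proved (not even for abelian data: (LL) is open); nothing of [B10]∕[7]∕[4] asserted; count-neutral helper toward R3 2′ (`stub_laneRecordsV3`, items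
19935∕19936); registry untouched; nothing about d = 4, the continuum, or a mass gap.

References: T. Bałaban, Commun. Math. Phys. 109 (1987) 249–301 [Balaban1987RG1] ((0.4), (0.11) p.253); CMP 102 (1985) 277–309 [Balaban1985Variational] ((2)+(8) pp.278–279);
CMP 98 (1985) 17–51 [Balaban1985Averaging] ((24) p.21).
-/

set_option autoImplicit false

noncomputable section

namespace Summit.QuantumFields.YangMills.Theorems

open MeasureTheory Set
open scoped Matrix.Norms.L2Operator
open Literature.MathematicalPhysics.QuantumFieldTheory.Balaban1983to89
open Literature.MathematicalPhysics.QuantumFieldTheory.Balaban1983to89.T3ContinuumYM3Torus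
open Literature.MathematicalPhysics.QuantumFieldTheory.Balaban1983to89.T3UnitLawDensityEML (ℰp)
open Literature.MathematicalPhysics.QuantumFieldTheory.Balaban1983to89.ExpMeanLog (deltaSU expMeanLogSU)
open Literature.MathematicalPhysics.QuantumFieldTheory.Balaban1983to89.B10Eq38TorusDomains (plaqsIn mem_plaqsIn_iff cornerSet toFine toFine_zero toFine_succ)
open Literature.MathematicalPhysics.QuantumFieldTheory.Balaban1983to89.B10Eq42TorusConstraint (bondsIn mem_bondsIn_iff lam42 lam42_self)
open Literature.MathematicalPhysics.QuantumFieldTheory.Balaban1985CMP102.Setting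
open Summit.QuantumFields.Balaban3D.Carriers
open Summit.QuantumFields.Balaban3D.Proofs.Primitives (AlphaConsts)
open Summit.QuantumFields.YangMills.Theorems.AbelianEML (gexpAt linAvgIter curlAt iter_blockAvg_gexpAt_region abs_curlAt_linAvgIter_le_region dist1_plaqHol_gexpAt_le)

section T3

variable {F : T3Family} {𝔠 : AlphaConsts F.L (suGroupModel 2).N} {γ : ℝ} {hγ : 0 < γ} {hγ1 : γ ≤ (min 𝔠.gamma0 1) ^ 2} {K : ℕ}

/-- At level `0` the nested family of `Ω_k(h)` is the region itself. [folklore] -/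
theorem AlphaInputsT3AC.mem_under_Omega_zero_iff (Ω : Set (Site (F.P K) 0)) (x : Site (F.P K) 0) :
    x ∈ {z : Site (F.P K) 0 | toFine 0 z ∈ Ω} ↔ x ∈ Ω := by
  simp [toFine_zero]

/-- **★★ (FL) FOR ABELIAN DATA FROM A LINEAR LIFT** (`k ≤ K`, `h` any history of the run): let `Y ∈ 𝔰𝔲(2) ∖ 0`, `A` a one-form on the bonds of `T^{(k)}` and `a` a one-form on the finest
bonds with (i) `linAvgIter k a = A` on `bondsIn k Ω_k(h)`, (ii) `|curl a (x; μ, ν)| ≤ B` at every finest unit square inside `Ω_k(h)` with `B·‖Y‖ < α·L^{−2k}`, (iii) the level thresholds.  Then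
`U := gexpAt a` has `(blockAvg ℰp)^k U = W` on `bondsIn k Ω_k(h)` for every `W` agreeing with `gexpAt A` there (`U ∈ top42Set k h W`), and every finest plaquette inside `Ω_k(h)` of `U` is
within `α·L^{−2k}` of `1`. [cite: Balaban1987RG1, (0.4)+(0.11) p.253; Balaban1985Variational, (2)+(8) pp.278–279] -/
theorem AlphaInputsT3AC.fineLift_of_linearLift_abelian {k : ℕ} (hk : k ≤ K) (h : Hist (F.P K) k)
    {Y : Matrix (Fin 2) (Fin 2) ℂ} (hY : Y ∈ (suGroupModel 2).lie) (hY0 : Y ≠ 0)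
    (A : PBond (F.P K) k → ℝ) (a : PBond (F.P K) 0 → ℝ)
    (hlin : ∀ b : PBond (F.P K) k, b ∈ bondsIn k (Omega 𝔠.lane.carrier.M₁
        (rcolOf (T3Scales F γ hγ (hγ1.trans (sq_min_one_le _ 𝔠.gamma0_pos)) K) 𝔠.lane.carrier) k h k) → linAvgIter k a b = A b)
    {B α : ℝ} (hB0 : 0 ≤ B)
    (hB : ∀ (x : Site (F.P K) 0) (μ ν : Fin 3), μ ≠ ν →
      x ∈ Omega 𝔠.lane.carrier.M₁ (rcolOf (T3Scales F γ hγ (hγ1.trans (sq_min_one_le _ 𝔠.gamma0_pos)) K) 𝔠.lane.carrier) k h k →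
      x.shift μ ∈ Omega 𝔠.lane.carrier.M₁ (rcolOf (T3Scales F γ hγ (hγ1.trans (sq_min_one_le _ 𝔠.gamma0_pos)) K) 𝔠.lane.carrier) k h k →
      x.shift ν ∈ Omega 𝔠.lane.carrier.M₁ (rcolOf (T3Scales F γ hγ (hγ1.trans (sq_min_one_le _ 𝔠.gamma0_pos)) K) 𝔠.lane.carrier) k h k →
      (x.shift μ).shift ν ∈ Omega 𝔠.lane.carrier.M₁ (rcolOf (T3Scales F γ hγ (hγ1.trans (sq_min_one_le _ 𝔠.gamma0_pos)) K) 𝔠.lane.carrier) k h k →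
      |curlAt a x μ ν| ≤ B)
    (hBα : B * ‖Y‖ < α * (((F.L : ℝ) ^ k)⁻¹) ^ 2)
    (hthr : ∀ s, s < k → Real.pi / 2 * (((((3 + 2) * F.L : ℕ) : ℝ) ^ 2 / 4) * (((F.L : ℝ) ^ 2) ^ s * B)) * ‖Y‖ < min (deltaSU (Fin 2)) (Real.log 2))
    (W : GaugeField (F.P K) k (Matrix.specialUnitaryGroup (Fin 2) ℂ))
    (hW : ∀ b : PBond (F.P K) k, b ∈ bondsIn k (Omega 𝔠.lane.carrier.M₁
        (rcolOf (T3Scales F γ hγ (hγ1.trans (sq_min_one_le _ 𝔠.gamma0_pos)) K) 𝔠.lane.carrier) k h k) → W b = gexpAt (suGroupModel 2) hY A b) :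
    gexpAt (suGroupModel 2) hY a ∈ AlphaInputsT3AC.top42Set F 𝔠 γ hγ hγ1 K k h W ∧
      ∀ q : Plaq (F.P K) 0, q ∈ plaqsIn 0 (Omega 𝔠.lane.carrier.M₁
          (rcolOf (T3Scales F γ hγ (hγ1.trans (sq_min_one_le _ 𝔠.gamma0_pos)) K) 𝔠.lane.carrier) k h k) →
        GaugeGroup.dist1 (GaugeField.plaqHol (gexpAt (suGroupModel 2) hY a) q) < α * (((F.L : ℝ) ^ k)⁻¹) ^ 2 := by
  set Ω : Set (Site (F.P K) 0) := Omega 𝔠.lane.carrier.M₁ (rcolOf (T3Scales F γ hγ (hγ1.trans (sq_min_one_le _ 𝔠.gamma0_pos)) K) 𝔠.lane.carrier) k h k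
    with hΩ
  have hkmK : k ≤ (F.P K).m + (F.P K).K := AlphaInputsT3AC.le_standing_of_le hk
  -- the nested family of the region
  have hR : ∀ i, i < k → ∀ z : Site (F.P K) i, z ∈ {z : Site (F.P K) i | toFine i z ∈ Ω} ↔ blockOf z ∈ {z : Site (F.P K) (i + 1) | toFine (i + 1) z ∈ Ω} :=
    fun i hi z => AlphaInputsT3AC.mem_under_Omega_iff_blockOf (hγ := hγ) (hγ1 := hγ1) hk h hi z
  have hB' : ∀ (x : Site (F.P K) 0) (μ ν : Fin (F.P K).d), μ ≠ ν → x ∈ {z : Site (F.P K) 0 | toFine 0 z ∈ Ω} →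
      x.shift μ ∈ {z : Site (F.P K) 0 | toFine 0 z ∈ Ω} → x.shift ν ∈ {z : Site (F.P K) 0 | toFine 0 z ∈ Ω} →
      (x.shift μ).shift ν ∈ {z : Site (F.P K) 0 | toFine 0 z ∈ Ω} → |curlAt a x μ ν| ≤ B := by
    intro x μ ν hμν h1 h2 h3 h4
    exact hB x μ ν hμν (by simpa [toFine_zero] using h1) (by simpa [toFine_zero] using h2) (by simpa [toFine_zero] using h3)
      (by simpa [toFine_zero] using h4)
  refine ⟨fun b hb => ?_, fun q hq => ?_⟩
  · -- exactness on `bondsIn k Ω_k(h)`: the regional EML identity at level `k`, then (i)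
    have hsrc : b.src ∈ {z : Site (F.P K) k | toFine k z ∈ Ω} := hb.1
    have htgt : b.tgt ∈ {z : Site (F.P K) k | toFine k z ∈ Ω} := hb.2
    have key := iter_blockAvg_gexpAt_region (P := F.P K) hY hY0 k hkmK (fun i => {z : Site (F.P K) i | toFine i z ∈ Ω}) hR a hB0 hB' hthr k le_rfl b hsrc htgt
    rw [hW b hb]
    show Averaging.iter (fun i => BlockAveraging.blockAvg (P := F.P K) (j := i) (expMeanLogSU (n := Fin 2))) k (gexpAt (suGroupModel 2) hY a) b = _
    rw [key]
    show gexpAt (suGroupModel 2) hY (linAvgIter k a) b = gexpAt (suGroupModel 2) hY A b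
    simp only [gexpAt, hlin b hb]
  · -- fine regularity inside `Ω_k(h)`
    obtain ⟨h1, h2, h3, h4⟩ := AlphaInputsT3AC.mem_plaqsIn_iff_corners.1 hq
    refine (dist1_plaqHol_gexpAt_le (suGroupModel 2) hY a q).trans_lt ?_
    have hcurl : |curlAt a q.src q.μ q.ν| ≤ B :=
      hB q.src q.μ q.ν (ne_of_lt q.hμν) (by simpa [toFine_zero] using h1) (by simpa [toFine_zero] using h2) (by simpa [toFine_zero] using h3)
        (by simpa [toFine_zero] using h4)
    exact (mul_le_mul_of_nonneg_right hcurl (norm_nonneg _)).trans_lt hBα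

/-- **THE LEVEL THRESHOLDS FROM THE FINE BUDGET**: if `B·‖Y‖ < α·L^{−2k}` and `(π/2)·(((d+2)L)²/4)·α ≤ min(δ_N, ln 2)`, then `(π/2)(((d+2)L)²/4)(L²)^s B‖Y‖ < min(δ_N, ln 2)` for every `s ≤ k`
(`(L²)^s·L^{−2k} ≤ 1`). [folklore] -/
theorem AlphaInputsT3AC.thresholds_of_fine_budget {k : ℕ} {Y : Matrix (Fin 2) (Fin 2) ℂ} {B α : ℝ} (hB0 : 0 ≤ B)
    (hBα : B * ‖Y‖ < α * (((F.L : ℝ) ^ k)⁻¹) ^ 2)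
    (hα : Real.pi / 2 * ((((3 + 2) * F.L : ℕ) : ℝ) ^ 2 / 4) * α ≤ min (deltaSU (Fin 2)) (Real.log 2)) :
    ∀ s, s < k → Real.pi / 2 * (((((3 + 2) * F.L : ℕ) : ℝ) ^ 2 / 4) * (((F.L : ℝ) ^ 2) ^ s * B)) * ‖Y‖ < min (deltaSU (Fin 2)) (Real.log 2) := by
  intro s hs
  have hL : (1 : ℝ) ≤ F.L := by exact_mod_cast le_of_lt F.hL.2
  have hL0 : (0 : ℝ) < F.L := by linarith
  have hN : (0 : ℝ) < (((3 + 2) * F.L : ℕ) : ℝ) := by exact_mod_cast (by have := F.hL.2; omega : 0 < (3 + 2) * F.L)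
  have hKd : 0 < Real.pi / 2 * ((((3 + 2) * F.L : ℕ) : ℝ) ^ 2 / 4) := by have := Real.pi_pos; positivity
  -- `(L²)^s · B‖Y‖ < (L²)^s · α L^{−2k} ≤ α`
  have hpow : ((F.L : ℝ) ^ 2) ^ s * (((F.L : ℝ) ^ k)⁻¹) ^ 2 ≤ 1 := by
    rw [← pow_mul, ← inv_pow, ← pow_mul, show (F.L : ℝ) ^ (2 * s) = ((F.L : ℝ) ^ s) ^ 2 by rw [mul_comm, pow_mul],
      show ((F.L : ℝ)⁻¹) ^ (k * 2) = (((F.L : ℝ)⁻¹) ^ k) ^ 2 by rw [pow_mul], ← mul_pow, inv_pow]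
    have h1 : (F.L : ℝ) ^ s * ((F.L : ℝ) ^ k)⁻¹ ≤ 1 := by
      rw [mul_inv_le_iff₀ (pow_pos hL0 k), one_mul]
      exact pow_le_pow_right₀ hL hs.le
    have h0 : 0 ≤ (F.L : ℝ) ^ s * ((F.L : ℝ) ^ k)⁻¹ := by positivity
    nlinarith
  have hα0 : 0 ≤ α := by
    have : 0 ≤ B * ‖Y‖ := mul_nonneg hB0 (norm_nonneg _)
    have hpos : 0 < (((F.L : ℝ) ^ k)⁻¹) ^ 2 := by positivity
    nlinarith
  have hmid : ((F.L : ℝ) ^ 2) ^ s * B * ‖Y‖ ≤ α := by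
    have h2 : ((F.L : ℝ) ^ 2) ^ s * (B * ‖Y‖) ≤ ((F.L : ℝ) ^ 2) ^ s * (α * (((F.L : ℝ) ^ k)⁻¹) ^ 2) :=
      mul_le_mul_of_nonneg_left hBα.le (by positivity)
    calc ((F.L : ℝ) ^ 2) ^ s * B * ‖Y‖ = ((F.L : ℝ) ^ 2) ^ s * (B * ‖Y‖) := by ring
      _ ≤ ((F.L : ℝ) ^ 2) ^ s * (α * (((F.L : ℝ) ^ k)⁻¹) ^ 2) := h2
      _ = α * (((F.L : ℝ) ^ 2) ^ s * (((F.L : ℝ) ^ k)⁻¹) ^ 2) := by ring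
      _ ≤ α * 1 := mul_le_mul_of_nonneg_left hpow hα0
      _ = α := mul_one α
  -- strictness: `B‖Y‖ < αL^{−2k}` gives a strict middle inequality unless `(L²)^s = 0`, impossible
  have hstrict : ((F.L : ℝ) ^ 2) ^ s * B * ‖Y‖ < α ∨ ((F.L : ℝ) ^ 2) ^ s * B * ‖Y‖ = α := lt_or_eq_of_le hmid
  have hlt : Real.pi / 2 * (((((3 + 2) * F.L : ℕ) : ℝ) ^ 2 / 4) * (((F.L : ℝ) ^ 2) ^ s * B)) * ‖Y‖ <
      Real.pi / 2 * ((((3 + 2) * F.L : ℕ) : ℝ) ^ 2 / 4) * α := by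
    have hps : 0 < ((F.L : ℝ) ^ 2) ^ s := by positivity
    have h3 : ((F.L : ℝ) ^ 2) ^ s * (B * ‖Y‖) < ((F.L : ℝ) ^ 2) ^ s * (α * (((F.L : ℝ) ^ k)⁻¹) ^ 2) := mul_lt_mul_of_pos_left hBα hps
    have h4 : ((F.L : ℝ) ^ 2) ^ s * (α * (((F.L : ℝ) ^ k)⁻¹) ^ 2) ≤ α := by
      calc ((F.L : ℝ) ^ 2) ^ s * (α * (((F.L : ℝ) ^ k)⁻¹) ^ 2) = α * (((F.L : ℝ) ^ 2) ^ s * (((F.L : ℝ) ^ k)⁻¹) ^ 2) := by ring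
        _ ≤ α * 1 := mul_le_mul_of_nonneg_left hpow hα0
        _ = α := mul_one α
    have h5 : ((F.L : ℝ) ^ 2) ^ s * (B * ‖Y‖) < α := h3.trans_le h4
    calc Real.pi / 2 * (((((3 + 2) * F.L : ℕ) : ℝ) ^ 2 / 4) * (((F.L : ℝ) ^ 2) ^ s * B)) * ‖Y‖
        = Real.pi / 2 * ((((3 + 2) * F.L : ℕ) : ℝ) ^ 2 / 4) * (((F.L : ℝ) ^ 2) ^ s * (B * ‖Y‖)) := by ring
      _ < Real.pi / 2 * ((((3 + 2) * F.L : ℕ) : ℝ) ^ 2 / 4) * α := mul_lt_mul_of_pos_left h5 hKd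
  exact hlt.trans_le hα

end T3

end Summit.QuantumFields.YangMills.Theorems

end
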